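import Literature.AlgebraicGeometry.HodgeTheory.DirectImageCovering
import Literature.AlgebraicGeometry.HodgeTheory.ComplexConjugation
import Mathlib.Topology.Homotopy.Lifting
import HarnessLib

/-!
# Transport in `Rᵏ π_* ℂ|_U` as the monodromy of the espace étalé; the local system on real carriers

Family `hodge`, layer `Literature/AlgebraicGeometry/HodgeTheory`. Continuation of
`DirectImageCovering`: for `π : 𝒳 ⟶ S` and a cohomologically locally trivial `U ⊆ S(ℂ)`
(`IsCohomologicallyLocallyTrivialOn π U`: the conclusion of Ehresmann's theorem and homotopy
invariance, Voisin I Thm. 9.3 / §9.2.1) the projection `FiberClass π k|_U → U` is a covering map, and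
this file turns its monodromy (Mathlib `IsCoveringMap.monodromy`: endpoint of the lifted path,
independent of the path up to homotopy) into the local system of the real carriers:

* `transportFun hU γ : Hᵏ(X_s(ℂ); ℂ) → Hᵏ(X_t(ℂ); ℂ)` for `γ : Path.Homotopic.Quotient s t` in `U`;
  `transportFun_refl`, `transportFun_trans` (functoriality), `transportFun_eq_of_path` /
  `exists_path_transportFun` (**characterisation by lifts**: `γ_* α = β` iff some path of fibre
  classes over `γ` joins `(s, α)` to `(t, β)` — uniqueness of lifts, Hatcher Prop. 1.34);
* `transportFun_op₂`, `transportFun_add`, `transportFun_smul`, `transportFun_cupProduct` —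
  transport commutes with every fibrewise operation induced from tube classes (the combined lift
  is continuous, `FiberClass.continuous_mk_op₂`), in particular it is `ℂ`-linear and
  multiplicative ("compatible with the cup-product", Voisin II §3.1.2);
* `localSystemOfRestrict π k hU : Motives.LocalSystem ℂ U` — **the functor `Π₁(U) ⥤ Mod_ℂ`,
  `s ↦ Hᵏ(X_s(ℂ); ℂ)`** (stalks are the real carriers `complexBetti (fiberOver π s) k` on the nose);
* `transportFun_map_fiberι` (restrictions of global classes are flat), `transportFun_fiberRestrict`
  (**local triviality by restriction**: inside a trivialising `B`, `γ_* (ξ|_{X_s}) = ξ|_{X_t}` — "the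
  stalk … is canonically isomorphic to `Hᵏ(X_t, A)` by restriction"), `transportFun_prop`
  (**continuation principle**: a fibrewise property stable along restrictions of tube classes over
  trivialising opens is preserved by transport — clopen subset of `[0, 1]`),
  `isRationalClass_transportFun` (transport preserves rational classes, granted rational descent
  along restriction over trivialising opens).

Not here: the packages `DirectImageLocalSystem` / `HyperplaneSectionLocalSystem`
(`HyperplaneSectionMonodromyProofs`), and any analytic input (Ehresmann for `π(ℂ)`).

## References

* [VoisinHodgeI2002] C. Voisin, Hodge Theory and Complex Algebraic Geometry I, CUP 2002, Thm. 9.3, §9.2.1.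
* [VoisinHodgeII2003] C. Voisin, Hodge Theory and Complex Algebraic Geometry II, CUP 2003, §3.1.2.
* [HatcherAT2002] A. Hatcher, Algebraic Topology, CUP 2002, §1.3 Prop. 1.30, 1.34.
-/

noncomputable section

open CategoryTheory AlgebraicGeometry
open _root_.Topology _root_.Filter
open Literature.AlgebraicTopology.SingularHomology

namespace Literature.AlgebraicGeometry.HodgeTheory

section HodgeTheory

variable {𝒳 S : Motives.SchemeOver ℂ} (π : 𝒳 ⟶ S) (k : ℕ) {U : Set (Motives.ComplexPoints S)}

/-! ### Transport along homotopy classes of paths in `U` -/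

/-- The point `(s, α)` of the espace étalé over `U`, in the fibre of the projection over `s`. [folklore] -/
def toProjFiber (s : U) (α : complexBetti (Motives.fiberOver π s.1) k) :
    projOver π k U ⁻¹' {s} :=
  ⟨⟨⟨s.1, α⟩, s.2⟩, rfl⟩

variable {π k} in
/-- A point of the fibre of the projection over `t` is `(t, β)` for its class `β` viewed in
`Hᵏ(X_t)`. [folklore] -/
theorem toProjFiber_clsAt {t : U} (e : projOver π k U ⁻¹' {t}) :
    toProjFiber π k t (e.1.1.clsAt (congrArg Subtype.val e.2)) = e := by
  obtain ⟨⟨⟨p, c⟩, hpU⟩, he⟩ := e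
  subst he
  rfl

/-- **Parallel transport** `Hᵏ(X_s(ℂ); ℂ) → Hᵏ(X_t(ℂ); ℂ)` along a homotopy class of paths in a
cohomologically locally trivial `U`: the monodromy of the covering space `FiberClass π k|_U → U`
(endpoint of the lifted path), i.e. continuation of a class as a locally constant family
("`R^k π_* A` is a local system"). [cite: VoisinHodgeI2002, §9.2.1] -/
def transportFun
    (hU : IsCohomologicallyLocallyTrivialOn π U)
    {s t : U} (γ : Path.Homotopic.Quotient s t) (α : complexBetti (Motives.fiberOver π s.1) k) :
    complexBetti (Motives.fiberOver π t.1) k :=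
  ((isCoveringMap_projOver π k hU).monodromy γ (toProjFiber π k s α)).1.1.clsAt
    (congrArg Subtype.val ((isCoveringMap_projOver π k hU).monodromy γ (toProjFiber π k s α)).2)

section Transport

variable (hU : IsCohomologicallyLocallyTrivialOn π U)

/-- Transport is the class of the monodromy image (rewriting lemma). [folklore] -/
theorem transportFun_eq_clsAt {s t : U} (γ : Path.Homotopic.Quotient s t)
    (α : complexBetti (Motives.fiberOver π s.1) k) (e : projOver π k U ⁻¹' {t})
    (he : (isCoveringMap_projOver π k hU).monodromy γ (toProjFiber π k s α) = e) :
    transportFun π k hU γ α = e.1.1.clsAt (congrArg Subtype.val e.2) := by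
  subst he
  rfl

/-- Transport along the constant path is the identity. [cite: VoisinHodgeI2002, §9.2.1] -/
theorem transportFun_refl (s : U) (α : complexBetti (Motives.fiberOver π s.1) k) :
    transportFun π k hU (Path.Homotopic.Quotient.refl s) α = α := by
  rw [transportFun_eq_clsAt π k hU _ α (toProjFiber π k s α)
    (by rw [(isCoveringMap_projOver π k hU).monodromy_refl]; rfl)]
  rfl

/-- Transport is compatible with concatenation. [cite: VoisinHodgeI2002, §9.2.1] -/
theorem transportFun_trans {s t w : U} (γ : Path.Homotopic.Quotient s t)
    (δ : Path.Homotopic.Quotient t w) (α : complexBetti (Motives.fiberOver π s.1) k) :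
    transportFun π k hU (γ.trans δ) α = transportFun π k hU δ (transportFun π k hU γ α) := by
  have h := toProjFiber_clsAt (t := t)
    ((isCoveringMap_projOver π k hU).monodromy γ (toProjFiber π k s α))
  rw [transportFun_eq_clsAt π k hU (γ.trans δ) α _
    ((isCoveringMap_projOver π k hU).monodromy_trans_apply γ δ _),
    transportFun_eq_clsAt π k hU δ (transportFun π k hU γ α)
      ((isCoveringMap_projOver π k hU).monodromy δ
        ((isCoveringMap_projOver π k hU).monodromy γ (toProjFiber π k s α))) ?_]
  unfold transportFun
  rw [h]

/-- **Transport is characterised by lifts**: if a path of fibre classes from `(s, α)` to `(t, β)`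
lies over the path `γ` of `U`, then transport along `γ` takes `α` to `β` (uniqueness of lifts in
a covering space). [cite: VoisinHodgeI2002, §9.2.1] -/
theorem transportFun_eq_of_path {s t : U} (γ : Path s t) {α : complexBetti (Motives.fiberOver π s.1) k}
    {β : complexBetti (Motives.fiberOver π t.1) k}
    (Γ : Path (⟨s.1, α⟩ : FiberClass π k) ⟨t.1, β⟩) (hΓ : ∀ u, (Γ u).pt = (γ u).1) :
    transportFun π k hU ⟦γ⟧ α = β := by
  have hΓU : ∀ u, Γ u ∈ fiberClassesOver π k U := fun u ↦ by
    rw [Set.mem_preimage, hΓ u]; exact (γ u).2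
  let Γ' : Path (toProjFiber π k s α).1 (toProjFiber π k t β).1 :=
    { toFun := fun u ↦ ⟨Γ u, hΓU u⟩
      continuous_toFun := Γ.continuous.subtype_mk _
      source' := Subtype.ext Γ.source
      target' := Subtype.ext Γ.target }
  have hmono : (isCoveringMap_projOver π k hU).monodromy ⟦γ⟧ (toProjFiber π k s α) =
      toProjFiber π k t β := by
    refine (isCoveringMap_projOver π k hU).monodromy_eq_of_map_eq ⟦Γ'⟧ ?_
    exact congrArg Path.Homotopic.Quotient.mk (Path.ext (funext fun u ↦ Subtype.ext (hΓ u)))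
  rw [transportFun_eq_clsAt π k hU _ α _ hmono]
  rfl

/-- **Existence of the lift**: transport along a path `γ` is the endpoint of a path of fibre
classes over `γ` starting at `(s, α)`. [cite: VoisinHodgeI2002, §9.2.1] -/
theorem exists_path_transportFun {s t : U} (γ : Path s t)
    (α : complexBetti (Motives.fiberOver π s.1) k) :
    ∃ Γ : Path (⟨s.1, α⟩ : FiberClass π k) ⟨t.1, transportFun π k hU ⟦γ⟧ α⟩,
      ∀ u, (Γ u).pt = (γ u).1 := by
  set cov := isCoveringMap_projOver π k hU
  have h0 : (γ : C(unitInterval, U)) 0 = projOver π k U (toProjFiber π k s α).1 := γ.source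
  let Γ₀ := cov.liftPath γ (toProjFiber π k s α).1 h0
  have hlift : ∀ u, projOver π k U (Γ₀ u) = γ u := fun u ↦ congr_fun (cov.liftPath_lifts γ _ h0) u
  have hmono : (cov.monodromy ⟦γ⟧ (toProjFiber π k s α)).1 = Γ₀ 1 := rfl
  have h1 : (Γ₀ 1).1 = ⟨t.1, transportFun π k hU ⟦γ⟧ α⟩ := by
    have := toProjFiber_clsAt (cov.monodromy ⟦γ⟧ (toProjFiber π k s α))
    rw [← hmono]
    exact (congrArg (fun e : projOver π k U ⁻¹' {t} ↦ e.1.1) this).symm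
  refine ⟨{ toFun := fun u ↦ (Γ₀ u).1
            continuous_toFun := continuous_subtype_val.comp Γ₀.continuous
            source' := by rw [cov.liftPath_zero]; rfl
            target' := h1 }, fun u ↦ ?_⟩
  exact congrArg Subtype.val (hlift u)

/-- Transport expressed through any continuous family of fibre classes over `γ`:
if `u ↦ (γ u, c u)` is continuous with `c 0 = α` then transport takes `α` to `c 1`.
[cite: VoisinHodgeI2002, §9.2.1] -/
theorem transportFun_eq_of_continuous {s t : U} (γ : Path s t)
    (c : ∀ u, complexBetti (Motives.fiberOver π (γ u).1) k)
    (hc : Continuous fun u ↦ (⟨(γ u).1, c u⟩ : FiberClass π k))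
    {α : complexBetti (Motives.fiberOver π s.1) k} {β : complexBetti (Motives.fiberOver π t.1) k}
    (h0 : (⟨(γ 0).1, c 0⟩ : FiberClass π k) = ⟨s.1, α⟩)
    (h1 : (⟨(γ 1).1, c 1⟩ : FiberClass π k) = ⟨t.1, β⟩) :
    transportFun π k hU ⟦γ⟧ α = β :=
  transportFun_eq_of_path π k hU γ
    { toFun := fun u ↦ ⟨(γ u).1, c u⟩, continuous_toFun := hc, source' := h0, target' := h1 }
    fun _ ↦ rfl

/-- The classes along a lifted path, viewed in the fibres over the base path. [folklore] -/
theorem continuous_mk_clsAt_path {s t : U} (γ : Path s t) {x y : FiberClass π k} (Γ : Path x y)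
    (hΓ : ∀ u, (Γ u).pt = (γ u).1) :
    Continuous fun u ↦ (⟨(γ u).1, (Γ u).clsAt (hΓ u)⟩ : FiberClass π k) := by
  convert Γ.continuous using 1
  ext u
  exact FiberClass.mk_clsAt _ _

/-- **Transport commutes with fibrewise operations induced from tubes** (sums, scalar multiples,
cup products …). [cite: VoisinHodgeII2003, §3.1.2] -/
theorem transportFun_op₂ {k₁ k₂ k₃ : ℕ}
    (F : ∀ t : Motives.ComplexPoints S, complexBetti (Motives.fiberOver π t) k₁ →
      complexBetti (Motives.fiberOver π t) k₂ → complexBetti (Motives.fiberOver π t) k₃)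
    (G : ∀ B : Set (Motives.ComplexPoints S), singularCohomology ℂ ℂ (tubeOver π B) k₁ →
      singularCohomology ℂ ℂ (tubeOver π B) k₂ → singularCohomology ℂ ℂ (tubeOver π B) k₃)
    (hFG : ∀ (B : Set (Motives.ComplexPoints S)) (t : Motives.ComplexPoints S) (ht : t ∈ B)
      (ξ₁ : singularCohomology ℂ ℂ (tubeOver π B) k₁) (ξ₂ : singularCohomology ℂ ℂ (tubeOver π B) k₂),
      F t (fiberRestrict π ht k₁ ξ₁) (fiberRestrict π ht k₂ ξ₂) = fiberRestrict π ht k₃ (G B ξ₁ ξ₂))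
    {s t : U} (γ : Path.Homotopic.Quotient s t) (a₁ : complexBetti (Motives.fiberOver π s.1) k₁)
    (a₂ : complexBetti (Motives.fiberOver π s.1) k₂) :
    transportFun π k₃ hU γ (F s.1 a₁ a₂) =
      F t.1 (transportFun π k₁ hU γ a₁) (transportFun π k₂ hU γ a₂) := by
  induction γ using Quotient.ind with
  | _ γ =>
  obtain ⟨Γ₁, hΓ₁⟩ := exists_path_transportFun π k₁ hU γ a₁
  obtain ⟨Γ₂, hΓ₂⟩ := exists_path_transportFun π k₂ hU γ a₂
  have hc := FiberClass.continuous_mk_op₂ π hU F G hFG (continuous_subtype_val.comp γ.continuous)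
    (fun u ↦ (γ u).2) (continuous_mk_clsAt_path π k₁ γ Γ₁ hΓ₁) (continuous_mk_clsAt_path π k₂ γ Γ₂ hΓ₂)
  refine transportFun_eq_of_continuous π k₃ hU γ _ hc ?_ ?_
  · refine FiberClass.mk_op₂ F ?_ ?_
    · rw [FiberClass.mk_clsAt, Γ₁.source]
    · rw [FiberClass.mk_clsAt, Γ₂.source]
  · refine FiberClass.mk_op₂ F ?_ ?_
    · rw [FiberClass.mk_clsAt, Γ₁.target]
    · rw [FiberClass.mk_clsAt, Γ₂.target]

/-- Transport is additive. [cite: VoisinHodgeI2002, §9.2.1] -/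
theorem transportFun_add {s t : U} (γ : Path.Homotopic.Quotient s t)
    (a b : complexBetti (Motives.fiberOver π s.1) k) :
    transportFun π k hU γ (a + b) = transportFun π k hU γ a + transportFun π k hU γ b :=
  transportFun_op₂ π hU (fun _ x y ↦ x + y) (fun _ ξ η ↦ ξ + η) (fun _ _ _ _ _ ↦ (map_add _ _ _).symm)
    γ a b

/-- Transport is `ℂ`-homogeneous. [cite: VoisinHodgeI2002, §9.2.1] -/
theorem transportFun_smul {s t : U} (γ : Path.Homotopic.Quotient s t) (c : ℂ)
    (a : complexBetti (Motives.fiberOver π s.1) k) :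
    transportFun π k hU γ (c • a) = c • transportFun π k hU γ a :=
  transportFun_op₂ π hU (k₂ := k) (fun _ x _ ↦ c • x) (fun _ ξ _ ↦ c • ξ)
    (fun _ _ _ _ _ ↦ (map_smul _ _ _).symm) γ a a

/-- Transport as a `ℂ`-linear map `Hᵏ(X_s(ℂ); ℂ) →ₗ Hᵏ(X_t(ℂ); ℂ)`. [cite: VoisinHodgeI2002, §9.2.1] -/
def transportLinear {s t : U} (γ : Path.Homotopic.Quotient s t) :
    complexBetti (Motives.fiberOver π s.1) k →ₗ[ℂ] complexBetti (Motives.fiberOver π t.1) k where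
  toFun := transportFun π k hU γ
  map_add' := transportFun_add π k hU γ
  map_smul' := transportFun_smul π k hU γ

/-- `transportLinear` is `transportFun`. [folklore] -/
@[simp]
theorem transportLinear_apply {s t : U} (γ : Path.Homotopic.Quotient s t)
    (a : complexBetti (Motives.fiberOver π s.1) k) :
    transportLinear π k hU γ a = transportFun π k hU γ a := rfl

/-- **The local system `Rᵏ π_* ℂ|_U` on the real carriers** `Hᵏ(X_s(ℂ); ℂ)`: the functor
`Π₁(U) ⥤ Mod_ℂ`, `s ↦ Hᵏ(X_s(ℂ); ℂ)`, `γ ↦` transport (monodromy of the espace étalé).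
[cite: VoisinHodgeI2002, §9.2.1] -/
def localSystemOfRestrict : Motives.LocalSystem ℂ U where
  obj s := complexBetti (Motives.fiberOver π s.as.1) k
  map {s t} γ := ModuleCat.ofHom (transportLinear π k hU γ)
  map_id s := by
    ext a
    simp only [ModuleCat.hom_ofHom]
    exact transportFun_refl π k hU s.as a
  map_comp {s t w} γ δ := by
    ext a
    simp only [ModuleCat.hom_ofHom]
    exact transportFun_trans π k hU γ δ a

/-- Transport in `localSystemOfRestrict` is `transportFun` (all identifications are identities).
[cite: VoisinHodgeI2002, §9.2.1] -/
@[simp]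
theorem localSystemOfRestrict_transport {s t : U} (γ : Path.Homotopic.Quotient s t)
    (a : complexBetti (Motives.fiberOver π s.1) k) :
    (localSystemOfRestrict π k hU).transport γ a = transportFun π k hU γ a := rfl

end Transport


section Consequences

variable (hU : IsCohomologicallyLocallyTrivialOn π U)

/-- **Restrictions of global classes are flat**: `γ_* (A|_{X_s}) = A|_{X_t}`.
[cite: VoisinHodgeII2003, §3.1.2] -/
theorem transportFun_map_fiberι {s t : U} (γ : Path.Homotopic.Quotient s t) (A : complexBetti 𝒳 k) :
    transportFun π k hU γ (complexBetti.map (Motives.fiberι π s.1) k A) =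
      complexBetti.map (Motives.fiberι π t.1) k A := by
  induction γ using Quotient.ind with | _ γ =>
  exact transportFun_eq_of_continuous π k hU γ
    (fun u ↦ complexBetti.map (Motives.fiberι π (γ u).1) k A)
    ((continuous_globalSection π k A).comp (continuous_subtype_val.comp γ.continuous))
    (by rw [γ.source]) (by rw [γ.target])

/-- **Local triviality by restriction**: inside an open `B` over which `γ` runs, transport of a
restricted tube class `ξ|_{X_s}` is `ξ|_{X_t}` ("the stalk … is canonically isomorphic to
`Hᵏ(X_t, A)` by restriction"). [cite: VoisinHodgeI2002, §9.2.1] -/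
theorem transportFun_fiberRestrict {B : Set (Motives.ComplexPoints S)} (hBo : IsOpen B) {s t : U}
    (γ : Path s t) (hγ : ∀ u, (γ u).1 ∈ B) (hs : s.1 ∈ B) (ht : t.1 ∈ B)
    (ξ : singularCohomology ℂ ℂ (tubeOver π B) k) :
    transportFun π k hU ⟦γ⟧ (fiberRestrict π hs k ξ) = fiberRestrict π ht k ξ := by
  have hγc : Continuous fun u : unitInterval ↦ (⟨(γ u).1, hγ u⟩ : B) :=
    (continuous_subtype_val.comp γ.continuous).subtype_mk _
  exact transportFun_eq_of_continuous π k hU γ (fun u ↦ fiberRestrict π (hγ u) k ξ)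
    ((continuous_tubeSection π k ⟨B, hBo⟩ ξ).comp hγc)
    (by
      have h0 : (γ 0).1 = s.1 := congrArg Subtype.val γ.source
      have h : (⟨(γ 0).1, hγ 0⟩ : B) = ⟨s.1, hs⟩ := Subtype.ext h0
      exact congrArg (tubeSection π k B ξ) h)
    (by
      have h1 : (γ 1).1 = t.1 := congrArg Subtype.val γ.target
      have h : (⟨(γ 1).1, hγ 1⟩ : B) = ⟨t.1, ht⟩ := Subtype.ext h1
      exact congrArg (tubeSection π k B ξ) h)

/-- Transport is multiplicative for the cup product. [cite: VoisinHodgeII2003, §3.1.2] -/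
theorem transportFun_cupProduct {p q r : ℕ} (h : p + q = r) {s t : U}
    (γ : Path.Homotopic.Quotient s t) (a : complexBetti (Motives.fiberOver π s.1) p)
    (b : complexBetti (Motives.fiberOver π s.1) q) :
    transportFun π r hU γ (cupProduct h a b) =
      cupProduct h (transportFun π p hU γ a) (transportFun π q hU γ b) :=
  transportFun_op₂ π hU (fun _ x y ↦ cupProduct h x y) (fun _ ξ η ↦ cupProduct h ξ η)
    (fun _ _ ht ξ η ↦ (cupProduct_map (fiberToTube π ht) h ξ η).symm) γ a b

variable {π k} in
/-- Equal fibre classes satisfy the same fibrewise predicates. [folklore] -/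
theorem FiberClass.prop_iff_of_mk_eq
    (P : ∀ t : Motives.ComplexPoints S, complexBetti (Motives.fiberOver π t) k → Prop)
    {p q : Motives.ComplexPoints S} {a : complexBetti (Motives.fiberOver π p) k}
    {b : complexBetti (Motives.fiberOver π q) k} (h : (⟨p, a⟩ : FiberClass π k) = ⟨q, b⟩) :
    P p a ↔ P q b := by
  obtain rfl : p = q := congrArg FiberClass.pt h
  rw [(FiberClass.mk_eq_mk_iff a b).1 h]

/-- **Continuation principle**: a fibrewise property which, on the restrictions of any tube class
over a trivialising open, holds at all points as soon as it holds at one, is preserved by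
transport (the set of parameters where it holds along a lift is open and closed in `[0, 1]`).
[cite: VoisinHodgeI2002, §9.2.1] -/
theorem transportFun_prop
    (P : ∀ t : Motives.ComplexPoints S, complexBetti (Motives.fiberOver π t) k → Prop)
    (hP : ∀ ⦃t : Motives.ComplexPoints S⦄, t ∈ U → ∃ B : Set (Motives.ComplexPoints S),
      IsOpen B ∧ t ∈ B ∧ B ⊆ U ∧
      (∀ (j : ℕ) ⦃s : Motives.ComplexPoints S⦄ (hs : s ∈ B), Function.Bijective (fiberRestrict π hs j)) ∧
      ∀ (ξ : singularCohomology ℂ ℂ (tubeOver π B) k) ⦃s s' : Motives.ComplexPoints S⦄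
        (hs : s ∈ B) (hs' : s' ∈ B), P s (fiberRestrict π hs k ξ) → P s' (fiberRestrict π hs' k ξ))
    {s t : U} (γ : Path.Homotopic.Quotient s t) {α : complexBetti (Motives.fiberOver π s.1) k}
    (hα : P s.1 α) : P t.1 (transportFun π k hU γ α) := by
  induction γ using Quotient.ind with | _ γ =>
  obtain ⟨Γ, hΓ⟩ := exists_path_transportFun π k hU γ α
  let c : ∀ u, complexBetti (Motives.fiberOver π (γ u).1) k := fun u ↦ (Γ u).clsAt (hΓ u)
  have hc : Continuous fun u ↦ (⟨(γ u).1, c u⟩ : FiberClass π k) :=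
    continuous_mk_clsAt_path π k γ Γ hΓ
  have hloc : ∀ u₀, ∀ᶠ u in 𝓝 u₀, (P (γ u).1 (c u) ↔ P (γ u₀).1 (c u₀)) := by
    intro u₀
    obtain ⟨B, hBo, h₀B, hBU, hbij, hPB⟩ := hP (γ u₀).2
    obtain ⟨ξ, hξ, h⟩ :=
      FiberClass.eventually_eq_fiberRestrict π k hU hc.continuousAt hBo hBU h₀B (hbij k h₀B)
    filter_upwards [h] with u hu
    obtain ⟨huB, hu⟩ := hu
    rw [hu, ← hξ]
    exact ⟨hPB ξ huB h₀B, hPB ξ h₀B huB⟩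
  have hclopen : IsClopen {u | P (γ u).1 (c u)} := by
    constructor
    · rw [← isOpen_compl_iff, isOpen_iff_mem_nhds]
      intro u₀ hu₀
      filter_upwards [hloc u₀] with u hu
      exact fun h ↦ hu₀ (hu.1 h)
    · rw [isOpen_iff_mem_nhds]
      intro u₀ hu₀
      filter_upwards [hloc u₀] with u hu
      exact hu.2 hu₀
  have h0 : P (γ 0).1 (c 0) :=
    (FiberClass.prop_iff_of_mk_eq P (by rw [FiberClass.mk_clsAt, Γ.source] :
      (⟨(γ 0).1, c 0⟩ : FiberClass π k) = ⟨s.1, α⟩)).2 hα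
  have huniv : {u | P (γ u).1 (c u)} = Set.univ :=
    (isClopen_iff.1 hclopen).resolve_left (Set.nonempty_iff_ne_empty.1 ⟨0, h0⟩)
  have h1 : P (γ 1).1 (c 1) := Set.eq_univ_iff_forall.1 huniv 1
  exact (FiberClass.prop_iff_of_mk_eq P (by rw [FiberClass.mk_clsAt, Γ.target] :
      (⟨(γ 1).1, c 1⟩ : FiberClass π k) = ⟨t.1, transportFun π k hU ⟦γ⟧ α⟩)).1 h1

/-- **Transport preserves rational classes**, granted that over trivialising opens a tube class
with one rational restriction is rational (as holds when the fibre inclusions are homotopy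
equivalences). [cite: VoisinHodgeII2003, §3.1.2] -/
theorem isRationalClass_transportFun
    (hrat : ∀ ⦃t : Motives.ComplexPoints S⦄, t ∈ U → ∃ B : Set (Motives.ComplexPoints S),
      IsOpen B ∧ t ∈ B ∧ B ⊆ U ∧
      (∀ (j : ℕ) ⦃s : Motives.ComplexPoints S⦄ (hs : s ∈ B), Function.Bijective (fiberRestrict π hs j)) ∧
      ∀ (j : ℕ) ⦃s : Motives.ComplexPoints S⦄ (hs : s ∈ B) (ξ : singularCohomology ℂ ℂ (tubeOver π B) j),
        IsRationalClass (fiberRestrict π hs j ξ) → IsRationalClass ξ)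
    {s t : U} (γ : Path.Homotopic.Quotient s t) {α : complexBetti (Motives.fiberOver π s.1) k}
    (hα : IsRationalClass α) : IsRationalClass (transportFun π k hU γ α) := by
  refine transportFun_prop π k hU (fun _ x ↦ IsRationalClass x) (fun t ht ↦ ?_) γ hα
  obtain ⟨B, hBo, htB, hBU, hbij, hB⟩ := hrat ht
  exact ⟨B, hBo, htB, hBU, hbij, fun ξ s s' hs hs' h ↦ (hB k hs ξ h).map (fiberToTube π hs')⟩

end Consequences

end HodgeTheory

end Literature.AlgebraicGeometry.HodgeTheory

end
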